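import Mathlib
import HarnessLib
import Summits.Langlands.Langlands.Theses.SkinnerWilesDefectOne
import Summits.Langlands.Langlands.Theorems.SkinnerWilesDefectOneReducibleOrdinaryProModularDefs
import Summits.Langlands.Langlands.Theorems.SkinnerWilesDefectOneReducibleOrdinaryProModularSmallReducibleSteinbergLocusThinAux
import Summits.Langlands.Langlands.Theorems.SkinnerWilesDefectOneReducibleOrdinaryProModularComplementRegimeClosedPointAux
import Literature.NumberTheory.GaloisRepresentations.NearlyOrdinaryDeformationRing
import Literature.NumberTheory.GaloisRepresentations.IntegralGaloisActionProofs

/-!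
# Characteristic-zero exclusion on the Steinberg locus: helper for the heart stub
# `stub_smallReducibleSteinbergLocusAligned` of line `steinberg-hyperplane`
# (crux `ReducibleOrdinaryProModular`, stmt-Langlands-12919)

Route `SkinnerWilesDefectOne`.  One more kernel-checked piece of the heart's case analysis (lead,
after wave 2; the "cheap corollary worth a sub-stub" flagged by the pin-lemma worker):

**a reducible Steinberg-shaped prime `𝔮` of characteristic zero never has a finite-order ratio.**
By the landed Steinberg pin (`steinbergPin_ratio`, …SmallReducibleSteinbergLocusThinAux) the ratio
`Ψ = ψ₀/ψ₁` of the diagonal characters of `ρ_𝒟 mod 𝔮` takes the value `q_w^{±1}` (`q_w = N w ≥ 2`) at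
every arithmetic Frobenius at `w`; if `Ψ` had finite order then `q_w` would be a root of unity in the
characteristic-zero field `Frac(R/𝔮)`, i.e. `q_wⁿ = 1` in `ℕ` — absurd.  Consequently the
finite-order-ratio part of `reducibleLocus ∩ steinbergLocus w` — the "closed-point stratum" that the
regime predicate `ClosedPointStratumLE` measures with its `CharP (R ⧸ 𝔮) p` antecedent — consists of
positive-characteristic primes ONLY (`not_charZero_or_not_hasFiniteOrderRatio`): in characteristic zero
every reducible Steinberg-shaped prime lies on the MOVING part `Ψ(Frob_w) = q_w^{±1}`, `Ψ` of infinite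
order, of the two hyperplanes (the Λ-adic strata of the card), never on the constant-`Ψ` pencil.
Frobenius elements exist at every prime above `w` (`exists_isArithFrobAt_of_mem_primesAbove_holds`).

The last theorem `stub_smallReducibleSteinbergLocusAligned_auxCharZeroExclusion` is the registered
one-line wrapper (sub-goal of stmt-Langlands-12919) through which this helper lands.

References: C. M. Skinner, A. J. Wiles, *Residually reducible representations and modular forms*,
Publ. Math. IHÉS 89 (1999), §2.2 (reducible deformations, Lemma 2.7: the constant-`Ψ` stratum) and
§2.3 ("nice": ratios of infinite order); the line card `Cruxes/ReducibleOrdinaryProModular/Lines/steinberg-hyperplane.md`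
(S3 (a)–(d)); wave-1/2 evidence on the item.
-/

set_option linter.dupNamespace false
set_option autoImplicit false

namespace Summit.Langlands.Langlands.Cruxes.ReducibleOrdinaryProModular.SteinbergHyperplane

open scoped NumberField MatrixGroups
open Filter NumberField IsDedekindDomain Field Polynomial Matrix
open Literature.NumberTheory.Automorphic Literature.NumberTheory.Automorphic.BigHeckeGLn
open Literature.NumberTheory.GaloisRepresentations
open Summit.Langlands.Langlands.Theses.SkinnerWilesDefectOne

noncomputable section

section CharZeroExclusion

variable {F : Type} [Field F] [NumberField F] {p : ℕ} [Fact p.Prime]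
variable {𝒪 : Type} [CommRing 𝒪] {k : Type} [Field k] [Algebra 𝒪 k] {𝒟 : NearlyOrdinaryDatum F p 𝒪 k}

omit [Fact p.Prime] in
/-- The residue cardinality `N w` of a finite place is at least `2` (the ideal is a non-zero proper
prime of `𝓞 F`). [folklore] -/
theorem one_lt_absNorm (w : HeightOneSpectrum (𝓞 F)) : 1 < Ideal.absNorm w.asIdeal := by
  have h0 : Ideal.absNorm w.asIdeal ≠ 0 := by
    rw [Ne, Ideal.absNorm_eq_zero_iff]
    exact w.ne_bot
  have h1 : Ideal.absNorm w.asIdeal ≠ 1 := by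
    rw [Ne, Ideal.absNorm_eq_one_iff]
    exact w.isPrime.ne_top
  omega

omit [Fact p.Prime] in
/-- In a characteristic-zero field a natural number `q ≥ 2` is not a root of unity: `(q : K)ⁿ = 1`
with `0 < n` is impossible. [folklore] -/
theorem natCast_pow_ne_one {K : Type*} [Field K] [CharZero K] {q : ℕ} (hq : 1 < q) {n : ℕ}
    (hn : 0 < n) : ((q : K)) ^ n ≠ 1 := by
  intro h
  have h' : ((q ^ n : ℕ) : K) = ((1 : ℕ) : K) := by push_cast; exact h
  have h'' : q ^ n = 1 := Nat.cast_injective h'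
  rcases Nat.pow_eq_one.mp h'' with h1 | h1
  · omega
  · omega

omit [Fact p.Prime] in
/-- **Characteristic-zero exclusion.**  A reducible Steinberg-shaped prime `𝔮` of `R_𝒟` with
`Frac(R/𝔮)` of characteristic zero does NOT have a finite-order ratio: at an arithmetic Frobenius at
`w` the ratio is `q_w^{±1}` (Steinberg pin), which has infinite order. [folklore] -/
theorem not_hasFiniteOrderRatio_of_mem_steinbergLocus (𝓡 : NearlyOrdinaryDeformationRing.{0} 𝒟)
    {w : HeightOneSpectrum (𝓞 F)} {𝔮 : PrimeSpectrum 𝓡.R} (hred : 𝔮 ∈ 𝓡.reducibleLocus)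
    (hSt : 𝔮 ∈ steinbergLocus 𝓡 w) [CharZero (FractionRing (𝓡.R ⧸ 𝔮.asIdeal))] :
    ¬ HasFiniteOrderRatio 𝓡 𝔮 := by
  intro hfin
  -- a global Borel frame over `Frac(R/𝔮)` (reducibility) and a Frobenius at `w`
  obtain ⟨P, hP⟩ := (exists_frame_iff_mem_reducibleLocus 𝓡 𝔮).mpr hred
  obtain ⟨𝔓, h𝔓⟩ := w.primesAbove_nonempty
  obtain ⟨σ, hσ⟩ := HeightOneSpectrum.exists_isArithFrobAt_of_mem_primesAbove_holds h𝔓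
  -- `q_w ≠ 0` in characteristic zero
  have hq1 : 1 < Ideal.absNorm w.asIdeal := one_lt_absNorm w
  have hq : (Ideal.absNorm w.asIdeal : FractionRing (𝓡.R ⧸ 𝔮.asIdeal)) ≠ 0 := by
    exact_mod_cast (show Ideal.absNorm w.asIdeal ≠ 0 by omega)
  -- the ratio character has finite order, hence so has its value at `σ`
  have hord := hfin P hP
  obtain ⟨n, hn, hpow⟩ := (isOfFinOrder_iff_pow_eq_one).mp hord
  have hσn : (Deformation.diagChar _ hP 0 σ / Deformation.diagChar _ hP 1 σ) ^ n = 1 := by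
    have := DFunLike.congr_fun hpow σ
    rwa [MonoidHom.pow_apply, MonoidHom.one_apply, MonoidHom.div_apply] at this
  -- but that value is `q^{±1}`
  have hqn : (Units.mk0 _ hq) ^ n = 1 := by
    rcases steinbergPin_ratio 𝓡 hSt P hP h𝔓 hσ hq with h | h
    · rwa [h] at hσn
    · rw [h, inv_pow, inv_eq_one] at hσn
      exact hσn
  have hval : ((Ideal.absNorm w.asIdeal : FractionRing (𝓡.R ⧸ 𝔮.asIdeal))) ^ n = 1 := by
    have := congrArg Units.val hqn
    rwa [Units.val_pow_eq_pow_val, Units.val_mk0, Units.val_one] at this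
  exact natCast_pow_ne_one hq1 hn hval

omit [Fact p.Prime] in
/-- Characteristic zero of the domain `R/𝔮` passes to its fraction field. [folklore] -/
theorem charZero_fractionRing_quotient (𝓡 : NearlyOrdinaryDeformationRing.{0} 𝒟)
    (𝔮 : PrimeSpectrum 𝓡.R) [CharZero (𝓡.R ⧸ 𝔮.asIdeal)] :
    CharZero (FractionRing (𝓡.R ⧸ 𝔮.asIdeal)) :=
  charZero_of_injective_algebraMap (IsFractionRing.injective (𝓡.R ⧸ 𝔮.asIdeal) _)

omit [Fact p.Prime] in
/-- **Dichotomy on the reducible Steinberg locus.**  Every reducible Steinberg-shaped prime `𝔮` either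
has `R/𝔮` of positive characteristic (then of characteristic `p`, `R` being local with residue
characteristic `p` — not proved here) or has a ratio of INFINITE order: the constant-`Ψ` (pencil /
closed-point-type) stratum of `reducibleLocus ∩ steinbergLocus w` lives entirely in positive
characteristic, where the regime predicate `ClosedPointStratumLE` measures it. [folklore] -/
theorem not_charZero_or_not_hasFiniteOrderRatio (𝓡 : NearlyOrdinaryDeformationRing.{0} 𝒟)
    {w : HeightOneSpectrum (𝓞 F)} {𝔮 : PrimeSpectrum 𝓡.R}
    (h : 𝔮 ∈ 𝓡.reducibleLocus ∩ steinbergLocus 𝓡 w) :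
    ¬ CharZero (𝓡.R ⧸ 𝔮.asIdeal) ∨ ¬ HasFiniteOrderRatio 𝓡 𝔮 := by
  by_cases hc : CharZero (𝓡.R ⧸ 𝔮.asIdeal)
  · haveI := charZero_fractionRing_quotient 𝓡 𝔮
    exact Or.inr (not_hasFiniteOrderRatio_of_mem_steinbergLocus 𝓡 h.1 h.2)
  · exact Or.inl hc

end CharZeroExclusion

/-! ## Registered wrapper -/

/-- **Registered sub-goal of `stub_smallReducibleSteinbergLocusAligned` (this helper file): on the
reducible Steinberg locus, characteristic zero excludes finite-order ratios.** [folklore] -/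
theorem stub_smallReducibleSteinbergLocusAligned_auxCharZeroExclusion :
    ∀ (F : Type) [Field F] [NumberField F] (p : ℕ) [Fact p.Prime] (𝒪 : Type) [CommRing 𝒪] (k : Type) [Field k] [Algebra 𝒪 k] (𝒟 : NearlyOrdinaryDatum F p 𝒪 k) (𝓡 : NearlyOrdinaryDeformationRing.{0} 𝒟) (w : HeightOneSpectrum (𝓞 F)) (𝔮 : PrimeSpectrum 𝓡.R), 𝔮 ∈ 𝓡.reducibleLocus → 𝔮 ∈ steinbergLocus 𝓡 w → CharZero (𝓡.R ⧸ 𝔮.asIdeal) → ¬ HasFiniteOrderRatio 𝓡 𝔮 :=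
  fun _ _ _ _ _ _ _ _ _ _ _ 𝓡 _ 𝔮 hred hSt hc =>
    haveI := hc
    haveI := charZero_fractionRing_quotient 𝓡 𝔮
    not_hasFiniteOrderRatio_of_mem_steinbergLocus 𝓡 hred hSt

end

end Summit.Langlands.Langlands.Cruxes.ReducibleOrdinaryProModular.SteinbergHyperplane
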